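import Summits.RiemannHypothesis.RiemannHypothesis.Theorems.HandoffReachCeiling
import Summits.RiemannHypothesis.RiemannHypothesis.Theorems.HandoffWindowTestLevel
import Literature.NumberTheory.LFunctions.ZetaFirstZeroCertificate
import HarnessLib

/-!
# THEOREM R for THEOREM V's margin, unconditional in the adversary (handoff prove-1, ATTEMPT-19, COROLLARY R-C)

Glue of `HandoffReachCeiling.log_reach_ceiling` (the reach ceiling given one window test seen at level
`η`) with `HandoffWindowTestLevel.adversary_level_le` (every window test is seen at level
`C_g²(W_{T₀} + c/(2(1+h²)))/‖g‖₂²`), for THEOREM V's margin constant `L = log π + 2S(2a+δ)`: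
`(2k+2)(log 2π + 2S(2a+δ) + c - K(1/4)) ≤ log η(g) - log κ_a + 2k log T₀`; and COROLLARY R-D
(`abs_infrared_lt_verified_height[_of_nearNullSamplingK]`): the k-FREE envelope `|h| < T₀` using the
strip-decay hypothesis only at the single point `1/2 + iT₀`.  RH-free; nothing here bears on the truth
of RH (paper: handoff/prove-1 ATTEMPT-19 §3).
-/

set_option linter.dupNamespace false  -- the mandated namespace repeats `RiemannHypothesis`

open scoped Real
open Complex MeasureTheory Set Filter Literature.NumberTheory.LFunctions
  Literature.Analysis.SpecialFunctions

namespace Summit.RiemannHypothesis.RiemannHypothesis.Theorems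

variable {g φ : ℝ → ℂ} {a δ : ℝ}

/-- **COROLLARY R-C (THEOREM V's margin).** With `L = log π + 2 S(2a + δ)` (THEOREM V): if
`NearNullSamplingK a φ T₀ h c θ p D k` holds together with THEOREM V's side conditions and `c ≥ 0`, then for
every window test `g` with `‖g‖₂ > 0` whose level `η = C_g² (W_{T₀} + c/(2(1+h²)))/‖g‖₂²` is below
`log π + 2S(2a+δ) - Re ψ(1/4)`,
`(2k+2)(log 2 + log π + 2 S(2a+δ) + c - K(1/4)) ≤ log η - log κ_a + 2k log T₀`. -/
theorem log_reach_ceiling_theoremV (hg : IsWeilTest g) (hsupp : tsupport g ⊆ Icc (-a) a) (ha : 0 < a)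
    (hφ : IsSplitKernel φ δ) {T₀ h c θ p D : ℝ} {k : ℕ} (hT₀ : 0 < T₀) (hθ0 : 0 ≤ θ)
    (hθ : ∀ t : ℝ, |t| < |h| → 1 - lineSymbol φ t ≤ θ) (hp : 0 ≤ p) (hc : 0 ≤ c)
    (hD : ∀ ρ : ℂ, 0 ≤ ρ.re → ρ.re ≤ 1 → ρ.im ≠ 0 →
      ‖weilMellin φ ρ‖ ≤ D ^ 2 / |ρ.im| ^ (2 * (k + 1)))
    (hh : Real.log π + 2 * primeSum (2 * a + δ) + c ≤ reDigammaQuarter h)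
    (hNNS : NearNullSamplingK a φ T₀ h c θ p D k) (hN : 0 < weilNorm2Sq g)
    (hlev : weilDecayConst g ^ 2 *
        ((∑ᶠ ρ ∈ weilZeroIndex T₀, (riemannZetaZeroOrder ρ : ℝ) / (1 + ρ.im ^ 2) ^ 2)
          + c / (2 * (1 + h ^ 2))) <
        (Real.log π + 2 * primeSum (2 * a + δ) - reDigammaQuarter 0) * weilNorm2Sq g) :
    (2 * k + 2) * (Real.log 2 + (Real.log π + 2 * primeSum (2 * a + δ)) + c - stirlingVertRate (1 / 4)) ≤
      Real.log (weilDecayConst g ^ 2 *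
        ((∑ᶠ ρ ∈ weilZeroIndex T₀, (riemannZetaZeroOrder ρ : ℝ) / (1 + ρ.im ^ 2) ^ 2)
          + c / (2 * (1 + h ^ 2))) / weilNorm2Sq g)
        - Real.log (8 * Real.log 2 * zetaDensityConst * a * Real.exp a) + 2 * k * Real.log T₀ := by
  set A := weilDecayConst g ^ 2 *
        ((∑ᶠ ρ ∈ weilZeroIndex T₀, (riemannZetaZeroOrder ρ : ℝ) / (1 + ρ.im ^ 2) ^ 2)
          + c / (2 * (1 + h ^ 2))) with hA
  set η := A / weilNorm2Sq g with hη
  have hadv := adversary_level_le hg hφ T₀ h hc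
  rw [← hA] at hadv
  have hηN : η * weilNorm2Sq g = A := by rw [hη]; field_simp
  have hη' : verifiedGramK g φ T₀ +
      c * (weilNorm2Sq g - (2 * π)⁻¹ * ∫ t in Ioo (-|h|) |h|, ‖weilMellin g (1 / 2 + t * I)‖ ^ 2)
        ≤ η * weilNorm2Sq g := by rw [hηN]; exact hadv
  have hηm : η < Real.log π + 2 * primeSum (2 * a + δ) - reDigammaQuarter 0 := by
    rw [hη, div_lt_iff₀ hN]; exact hlev
  have hX := infrared_le_of_adversary hg hsupp ha.le hφ hT₀ hθ0 hθ hp hc hD hh hNNS hN hηm hη'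
  have hLπ : Real.log π ≤ Real.log π + 2 * primeSum (2 * a + δ) := by
    linarith [primeSum_nonneg (2 * a + δ)]
  have hh2 := two_lt_abs_infrared (L := Real.log π + 2 * primeSum (2 * a + δ)) hc hLπ hh
  have hA₁ := zetaDensityConst_pos
  have hl2 : 0 < Real.log 2 := Real.log_pos (by norm_num)
  have hη0 : 0 < η := by
    have : 0 < 8 * Real.log 2 * zetaDensityConst * a * Real.exp a * |h| ^ (2 * (k + 1)) / T₀ ^ (2 * k) := by
      have : 0 < |h| := by linarith
      positivity
    linarith
  exact log_reach_ceiling hg hsupp ha hφ hT₀ hθ0 hθ hp hc hD hLπ hh hNNS hN hη0 hηm hη'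

/-! ### COROLLARY R-D: the infrared height lies below the verified height (k-free; decay used at ONE point) -/

/-- **COROLLARY R-D (k-free envelope; strip decay used only at the single point `1/2 + iT₀`).**
Let `φ` be a split kernel with transparency `θ ∈ [0,1]` below `|h|`, margin `L + c ≤ Re ψ(1/4+ih/2)` with
`c ≥ 0`, `p ≥ 0`, and suppose only that `‖φ̂(1/2 + iT₀)‖ ≤ D²/T₀^{2k+2}` (the one value of the strip-decay
hypothesis that a tariff over the unverified zeros `|γ| > T₀` cannot avoid).  If the near-null sampling
inequality holds at ONE window test `g` which the certificate's form sees at a level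
`η < min(κ_a T₀², L - Re ψ(1/4))`, then `|h| < T₀`: the infrared height is below the verified height.
(If `T₀ ≤ |h|`, transparency at `t = T₀` gives `D² ≥ (1-θ) T₀^{2k+2}`, an `O(1)` floor under the tariff.) -/
theorem abs_infrared_lt_verified_height (hg : IsWeilTest g) (hφ : IsSplitKernel φ δ) (ha : 0 ≤ a)
    {T₀ h c θ p D L η : ℝ} {k : ℕ} (hT₀ : 0 < T₀) (hθ0 : 0 ≤ θ) (hθ1 : θ ≤ 1)
    (hθ : ∀ t : ℝ, |t| < |h| → 1 - lineSymbol φ t ≤ θ) (hp : 0 ≤ p) (hc : 0 ≤ c)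
    (hDT : ‖weilMellin φ (1 / 2 + T₀ * I)‖ ≤ D ^ 2 / T₀ ^ (2 * (k + 1)))
    (hL : L + c ≤ reDigammaQuarter h)
    (hNNSg : splitTariff a T₀ h θ p D k * weilNorm2Sq g ≤ verifiedGramK g φ T₀ + c * highMassK g φ)
    (hN : 0 < weilNorm2Sq g)
    (hη : verifiedGramK g φ T₀ +
        c * (weilNorm2Sq g - (2 * π)⁻¹ * ∫ t in Ioo (-|h|) |h|, ‖weilMellin g (1 / 2 + t * I)‖ ^ 2)
        ≤ η * weilNorm2Sq g)
    (hηlt : η < min (8 * Real.log 2 * zetaDensityConst * a * Real.exp a * T₀ ^ 2)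
        (L - reDigammaQuarter 0)) :
    |h| < T₀ := by
  by_contra hle
  rw [not_lt] at hle
  set N := weilNorm2Sq g with hN'
  set B := (2 * π)⁻¹ * ∫ t in Ioo (-|h|) |h|, ‖weilMellin g (1 / 2 + t * I)‖ ^ 2 with hB
  set κ := 8 * Real.log 2 * zetaDensityConst * a * Real.exp a with hκ
  set m := L - reDigammaQuarter 0 with hm
  have hA₁ := zetaDensityConst_pos
  have hl2 : 0 ≤ Real.log 2 := Real.log_nonneg (by norm_num)
  have hκ0 : 0 ≤ κ := by positivity
  have hN0 : 0 ≤ N := weilNorm2Sq_nonneg g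
  have hBN : B ≤ N := band_le_weilNorm2Sq hg h
  -- transparency at `t = T₀` (closed band, `h ≠ 0` since `T₀ > 0`)
  have hh0 : h ≠ 0 := by
    intro h0; rw [h0, abs_zero] at hle; linarith
  have hT1 : 1 - lineSymbol φ T₀ ≤ θ :=
    one_sub_lineSymbol_le_of_abs_le hφ hh0 hθ (by rw [abs_of_pos hT₀]; exact hle)
  have hT2 : lineSymbol φ T₀ ≤ ‖weilMellin φ (1 / 2 + T₀ * I)‖ := Complex.re_le_norm _
  have hpow : 0 < T₀ ^ (2 * (k + 1)) := pow_pos hT₀ _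
  have hD2 : (1 - θ) * T₀ ^ (2 * (k + 1)) ≤ D ^ 2 := by
    have : 1 - θ ≤ D ^ 2 / T₀ ^ (2 * (k + 1)) := by linarith
    rwa [le_div_iff₀ hpow] at this
  -- the `O(1)` tariff floor: `κ (1-θ) T₀² + (W_h - W_0) θ + 4 p a e^a ≤ τ`
  have hT : 0 < T₀ ^ (2 * k) := pow_pos hT₀ _
  have hfloor : κ * (1 - θ) * T₀ ^ 2 + (reDigammaQuarter h - reDigammaQuarter 0) * θ
      + 4 * p * a * Real.exp a ≤ splitTariff a T₀ h θ p D k := by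
    unfold splitTariff
    have e : T₀ ^ (2 * (k + 1)) = T₀ ^ (2 * k) * T₀ ^ 2 := by ring
    have h1 : κ * ((1 - θ) * T₀ ^ (2 * (k + 1))) / T₀ ^ (2 * k) ≤ κ * D ^ 2 / T₀ ^ (2 * k) :=
      div_le_div_of_nonneg_right (mul_le_mul_of_nonneg_left hD2 hκ0) hT.le
    have e2 : κ * ((1 - θ) * T₀ ^ (2 * (k + 1))) / T₀ ^ (2 * k) = κ * (1 - θ) * T₀ ^ 2 := by
      rw [e]; field_simp
    rw [e2] at h1
    have e3 : κ * D ^ 2 / T₀ ^ (2 * k) =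
        8 * Real.log 2 * zetaDensityConst * a * Real.exp a * D ^ 2 / T₀ ^ (2 * k) := by rw [hκ]
    linarith
  -- NNS at `g` with `M ≤ θ N + (N - B)`
  have hM := highMassK_le_band_add_tail hg hφ hθ
  have hcM : c * highMassK g φ ≤ c * θ * N + c * (N - B) := by
    have h1 : highMassK g φ ≤ θ * N + (N - B) := by
      have : θ * B ≤ θ * N := mul_le_mul_of_nonneg_left hBN hθ0
      linarith
    nlinarith
  have hmain : (κ * (1 - θ) * T₀ ^ 2 + (reDigammaQuarter h - reDigammaQuarter 0 - c) * θ
      + 4 * p * a * Real.exp a) * N ≤ η * N := by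
    have := mul_le_mul_of_nonneg_right hfloor hN0
    nlinarith
  have hcoef : min (κ * T₀ ^ 2) m ≤ κ * (1 - θ) * T₀ ^ 2
      + (reDigammaQuarter h - reDigammaQuarter 0 - c) * θ + 4 * p * a * Real.exp a := by
    have h1 : min (κ * T₀ ^ 2) m ≤ κ * T₀ ^ 2 := min_le_left _ _
    have h2 : min (κ * T₀ ^ 2) m ≤ m := min_le_right _ _
    have h3 : m ≤ reDigammaQuarter h - reDigammaQuarter 0 - c := by rw [hm]; linarith
    have h4 : 0 ≤ 4 * p * a * Real.exp a := by positivity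
    nlinarith [mul_le_mul_of_nonneg_right h1 (sub_nonneg.2 hθ1), mul_le_mul_of_nonneg_right h2 hθ0,
      mul_le_mul_of_nonneg_right h3 hθ0]
  have hfin : min (κ * T₀ ^ 2) m * N ≤ η * N := (mul_le_mul_of_nonneg_right hcoef hN0).trans hmain
  have : min (κ * T₀ ^ 2) m ≤ η := le_of_mul_le_mul_right hfin hN
  rw [hκ, hm] at this
  linarith

/-- **COROLLARY R-D for `NearNullSamplingK`** (any `θ ≥ 0`): under the hypotheses of R-D with the full
sampling hypothesis, `|h| < T₀`, hence `L + c < log(T₀/2) + K(1/4)` whenever `L ≥ log π`. -/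
theorem abs_infrared_lt_verified_height_of_nearNullSamplingK (hg : IsWeilTest g)
    (hsupp : tsupport g ⊆ Icc (-a) a) (hφ : IsSplitKernel φ δ) (ha : 0 ≤ a)
    {T₀ h c θ p D L η : ℝ} {k : ℕ} (hT₀ : 0 < T₀) (hθ0 : 0 ≤ θ)
    (hθ : ∀ t : ℝ, |t| < |h| → 1 - lineSymbol φ t ≤ θ) (hp : 0 ≤ p) (hc : 0 ≤ c)
    (hDT : ‖weilMellin φ (1 / 2 + T₀ * I)‖ ≤ D ^ 2 / T₀ ^ (2 * (k + 1)))
    (hL : L + c ≤ reDigammaQuarter h) (hNNS : NearNullSamplingK a φ T₀ h c θ p D k)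
    (hN : 0 < weilNorm2Sq g)
    (hη : verifiedGramK g φ T₀ +
        c * (weilNorm2Sq g - (2 * π)⁻¹ * ∫ t in Ioo (-|h|) |h|, ‖weilMellin g (1 / 2 + t * I)‖ ^ 2)
        ≤ η * weilNorm2Sq g)
    (hηlt : η < min (8 * Real.log 2 * zetaDensityConst * a * Real.exp a * T₀ ^ 2)
        (L - reDigammaQuarter 0)) :
    |h| < T₀ := by
  have hNNSg := hNNS g hg hsupp
  by_cases hθ1 : θ ≤ 1
  · exact abs_infrared_lt_verified_height hg hφ ha hT₀ hθ0 hθ1 hθ hp hc hDT hL hNNSg hN hη hηlt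
  have hθ' : ∀ t : ℝ, |t| < |h| → 1 - lineSymbol φ t ≤ 1 := fun t _ ↦ by
    have := hφ.line_nonneg t
    unfold lineSymbol; linarith
  have hmono : splitTariff a T₀ h 1 p D k ≤ splitTariff a T₀ h θ p D k := by
    unfold splitTariff
    have hWw : 0 ≤ reDigammaQuarter h - reDigammaQuarter 0 := by
      linarith [reDigammaQuarter_zero_le h]
    nlinarith [not_le.1 hθ1]
  have hNNSg' : splitTariff a T₀ h 1 p D k * weilNorm2Sq g ≤
      verifiedGramK g φ T₀ + c * highMassK g φ :=
    (mul_le_mul_of_nonneg_right hmono (weilNorm2Sq_nonneg g)).trans hNNSg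
  exact abs_infrared_lt_verified_height hg hφ ha hT₀ zero_le_one le_rfl hθ' hp hc hDT hL hNNSg' hN hη
    hηlt

/-- **COROLLARY R-D, logarithmic form for THEOREM V's margin.** Under the hypotheses of
`abs_infrared_lt_verified_height_of_nearNullSamplingK` with `L = log π + 2 S(2a+δ)`:
`log 2 + log π + 2 S(2a+δ) + c < log T₀ + K(1/4)` — twice the prime sum up to `q⁺ e^δ` is below the
logarithm of the verified height (k-free; decay used only at `1/2 + iT₀`). -/
theorem two_primeSum_add_margin_lt_log_verified_height (hg : IsWeilTest g)
    (hsupp : tsupport g ⊆ Icc (-a) a) (hφ : IsSplitKernel φ δ) (ha : 0 ≤ a)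
    {T₀ h c θ p D η : ℝ} {k : ℕ} (hT₀ : 0 < T₀) (hθ0 : 0 ≤ θ)
    (hθ : ∀ t : ℝ, |t| < |h| → 1 - lineSymbol φ t ≤ θ) (hp : 0 ≤ p) (hc : 0 ≤ c)
    (hDT : ‖weilMellin φ (1 / 2 + T₀ * I)‖ ≤ D ^ 2 / T₀ ^ (2 * (k + 1)))
    (hh : Real.log π + 2 * primeSum (2 * a + δ) + c ≤ reDigammaQuarter h)
    (hNNS : NearNullSamplingK a φ T₀ h c θ p D k) (hN : 0 < weilNorm2Sq g)
    (hη : verifiedGramK g φ T₀ +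
        c * (weilNorm2Sq g - (2 * π)⁻¹ * ∫ t in Ioo (-|h|) |h|, ‖weilMellin g (1 / 2 + t * I)‖ ^ 2)
        ≤ η * weilNorm2Sq g)
    (hηlt : η < min (8 * Real.log 2 * zetaDensityConst * a * Real.exp a * T₀ ^ 2)
        (Real.log π + 2 * primeSum (2 * a + δ) - reDigammaQuarter 0)) :
    Real.log 2 + Real.log π + 2 * primeSum (2 * a + δ) + c <
      Real.log T₀ + stirlingVertRate (1 / 4) := by
  have hlt := abs_infrared_lt_verified_height_of_nearNullSamplingK hg hsupp hφ ha hT₀ hθ0 hθ hp hc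
    hDT hh hNNS hN hη hηlt
  have hLπ : Real.log π ≤ Real.log π + 2 * primeSum (2 * a + δ) := by
    linarith [primeSum_nonneg (2 * a + δ)]
  have hh2 := two_lt_abs_infrared (L := Real.log π + 2 * primeSum (2 * a + δ)) hc hLπ hh
  have hhpos : 0 < |h| := by linarith
  have hW := hh.trans (reDigammaQuarter_le_log_half_add h hh2.le)
  have hlog : Real.log (|h| / 2) < Real.log (T₀ / 2) :=
    Real.log_lt_log (by positivity) (by linarith)
  have e1 : Real.log (T₀ / 2) = Real.log T₀ - Real.log 2 := Real.log_div hT₀.ne' two_ne_zero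
  linarith

/-- **The density constant from below**: `1/log(259/16) ≤ A₁` (at `t = γ₀ ≤ 227/16` the local density
series is `≥ 1`, and `A₁ log(|γ₀| + 2)` dominates it).  With `log(259/16) < 2.79` this gives `A₁ > 0.358`,
the conservative direction for the ceiling constant `κ_a = 8 log 2 · A₁ · a e^a`. -/
theorem inv_log_le_zetaDensityConst : 1 / Real.log (259 / 16) ≤ zetaDensityConst := by
  set t := zetaOrdinate 0 with ht
  have h := tsum_density_le_zetaDensityConst t
  have hterm : (1 : ℝ) ≤ ∑' n : ℕ, 1 / (1 + (t - zetaOrdinate n) ^ 2) := by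
    have := (Montgomery.summable_firstWeight t).le_tsum 0 (fun j _ ↦ by positivity)
    simpa [t] using this
  have h14 : 14 < t := fourteen_lt_zetaOrdinate_zero_holds
  have hle : t ≤ 227 / 16 := zetaOrdinate_zero_le
  have habs : |t| + 2 ≤ 259 / 16 := by rw [abs_of_pos (by linarith)]; linarith
  have hlog0 : 0 < Real.log (|t| + 2) := Real.log_pos (by linarith [abs_nonneg t])
  have hlog1 : Real.log (|t| + 2) ≤ Real.log (259 / 16) :=
    Real.log_le_log (by linarith [abs_nonneg t]) habs
  have hA := zetaDensityConst_nonneg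
  have h1 : 1 ≤ zetaDensityConst * Real.log (259 / 16) :=
    hterm.trans (h.trans (mul_le_mul_of_nonneg_left hlog1 hA))
  have hlog2 : 0 < Real.log (259 / 16) := Real.log_pos (by norm_num)
  rw [div_le_iff₀ hlog2]; linarith

end Summit.RiemannHypothesis.RiemannHypothesis.Theorems
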